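import Summits.Ventures.HodgeRepro2.T5BergmanKTypeMatrix

/-!
# The `K`-finite matrix coefficients of `π_k` are integrable on `SU(1,1)` for `k ≥ 4`

`|a(g)|^{-4}` is integrable against every Haar measure of `SU(1,1)` — it is, up to the constant `π²`,
the square of the lowest-weight coefficient of the weight-`2` model (`T5BergmanSchur.integrable_norm_coeffLowest_sq`
at `k = 2`, `h = 1`, with `1 - |orbit g|² = |a(g)|^{-2}`) — and `|a(g)| ≥ 1`, so `|a(g)|^{-s}` is integrable
for every `s ≥ 4` (`integrable_norm_mat_inv_pow`). With the decay bound
`|⟨π_k(g) zᵐ, zⁿ⟩_k| ≤ C_{m,n} ⟨zⁿ,zⁿ⟩_k |a(g)|^{-k}` of `T5BergmanKTypeMatrix` this gives: for `k ≥ 4`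
every `K`-finite matrix coefficient `g ↦ ⟨π_k(g) zᵐ, zⁿ⟩_k` is INTEGRABLE against every Haar measure of
`SU(1,1)` (`integrable_matrixCoeff_monomial_monomial`) — the weight-`k` discrete series is an integrable
representation for `k ≥ 4` (for `k = 2, 3` the coefficients are square-integrable by
`T5BergmanSchurGeneral`; the `L¹`-question for `k = 3` needs the half-integer power
`∫_𝔻 (1-|z|²)^{-1/2} dA`, not computed here).

Blind lane: Mathlib + the HodgeRepro2 prefix only; no sorry; axioms ⊆ {propext, Classical.choice,
Quot.sound}.
-/

namespace Summit.Ventures.HodgeRepro2.T5BergmanIntegrableCoeff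

open MeasureTheory MeasureTheory.Measure Metric Filter Topology
open T5PoincareDensity T5SU11Unimodular T5SU11Fibration T5HaarCircle
open T5BergmanCoefficient T5BergmanPairing T5BergmanUnitary T5BergmanFourier T5BergmanKernel
  T5BergmanParseval T5BergmanActStable T5BergmanMatrixCoeff T5BergmanSchur T5BergmanSchurGeneral
  T5BergmanKTypeMatrix
open scoped Real

/-- `|a(g)| ≥ 1` on `SU(1,1)` (as `|a|² - |b|² = 1`). -/
lemma one_le_norm_mat (g : SU11) : 1 ≤ ‖mat g 0 0‖ := by
  have h := norm_sq_sub_norm_sq g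
  nlinarith [norm_nonneg (mat g 0 0), norm_nonneg (mat g 0 1), sq_nonneg (‖mat g 0 0‖ - 1)]

variable [MeasurableSpace Circle] [BorelSpace Circle]

/-- **`|a(g)|^{-4}` is integrable** against every Haar measure of `SU(1,1)`: it is `π^{-2}` times the square
of the lowest-weight coefficient of the weight-`2` model. -/
theorem integrable_norm_mat_inv_pow_four (μ : Measure SU11) [IsHaarMeasure μ] :
    Integrable (fun g => ‖mat g 0 0‖⁻¹ ^ 4) μ := by
  have hint : IntegrableOn (fun w => ‖lowest w‖ ^ 2 * (1 - ‖w‖ ^ 2) ^ (2 - 2)) (ball (0 : ℂ) 1) := by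
    simp [lowest]
  have h := integrable_norm_coeffLowest_sq μ 2 le_rfl _ lowest (hasSum_taylor _ (differentiableOn_const 1))
    hint
  have e : ∀ g : SU11, ‖coeffLowest 2 lowest g‖ ^ 2 = π ^ 2 * ‖mat g 0 0‖⁻¹ ^ 4 := by
    intro g
    rw [norm_coeffLowest_sq 2 le_rfl _ lowest (hasSum_taylor _ (differentiableOn_const 1)) hint g,
      one_sub_norm_orbit_sq g]
    simp only [lowest, norm_one, one_pow, mul_one, Nat.cast_ofNat]
    norm_num
    ring
  simp_rw [e] at h
  have hπ : (π ^ 2 : ℝ) ≠ 0 := by positivity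
  have := h.const_mul (π ^ 2)⁻¹
  refine this.congr (Eventually.of_forall fun g => ?_)
  simp only
  field_simp

/-- **`|a(g)|^{-s}` is integrable for every `s ≥ 4`** (`|a| ≥ 1`). -/
theorem integrable_norm_mat_inv_pow (μ : Measure SU11) [IsHaarMeasure μ] (s : ℕ) (hs : 4 ≤ s) :
    Integrable (fun g => ‖mat g 0 0‖⁻¹ ^ s) μ := by
  refine (integrable_norm_mat_inv_pow_four μ).mono' ?_ (Eventually.of_forall fun g => ?_)
  · exact ((continuous_mat00.norm.inv₀ fun g => (norm_pos_iff.mpr (mat_zero_zero_ne_zero g)).ne').pow s).aestronglyMeasurable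
  · have h1 := one_le_norm_mat g
    have hpos : 0 < ‖mat g 0 0‖ := by linarith
    have hinv : ‖mat g 0 0‖⁻¹ ≤ 1 := inv_le_one_of_one_le₀ h1
    have hinv0 : 0 ≤ ‖mat g 0 0‖⁻¹ := by positivity
    rw [Real.norm_eq_abs, abs_of_nonneg (by positivity)]
    exact pow_le_pow_of_le_one hinv0 hinv hs

/-- **The `K`-finite matrix coefficients are integrable for `k ≥ 4`**: `g ↦ ⟨π_k(g) zᵐ, zⁿ⟩_k` is
integrable against every Haar measure of `SU(1,1)`. -/
theorem integrable_matrixCoeff_monomial_monomial (μ : Measure SU11) [IsHaarMeasure μ] (k : ℕ)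
    (hk : 4 ≤ k) (m n : ℕ) :
    Integrable (matrixCoeff k (fun z => z ^ m) (fun z => z ^ n)) μ := by
  have hk2 : 2 ≤ k := by omega
  have hcont : Continuous (matrixCoeff k (fun z => z ^ m) (fun z => z ^ n)) :=
    continuous_matrixCoeff_of_differentiableOn k hk2 _ (differentiableOn_monomial m)
      (integrableOn_monomial k m) _ (differentiableOn_monomial n) (integrableOn_monomial k n)
  refine ((integrable_norm_mat_inv_pow μ k hk).const_mul (decayConst k m n * monomialNormSq k n)).mono'
    hcont.aestronglyMeasurable (Eventually.of_forall fun g => ?_)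
  exact norm_matrixCoeff_monomial_monomial_le k hk2 g m n

/-- The same for the translated lowest-weight vector against a monomial (`m = 0`). -/
theorem integrable_matrixCoeff_lowest_monomial (μ : Measure SU11) [IsHaarMeasure μ] (k : ℕ)
    (hk : 4 ≤ k) (n : ℕ) :
    Integrable (matrixCoeff k lowest (fun z => z ^ n)) μ := by
  have h := integrable_matrixCoeff_monomial_monomial μ k hk 0 n
  refine h.congr (Eventually.of_forall fun g => ?_)
  exact matrixCoeff_congr (fun z _ => by simp [lowest]) (fun _ _ => rfl) g

end Summit.Ventures.HodgeRepro2.T5BergmanIntegrableCoeff
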